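import Literature.Topology.FourManifolds.HostFlatten
import Literature.Topology.FourManifolds.StageOrientationSign
import HarnessLib

/-!
# The reflected template knot of a flip pair is an affine template knot

Topic `Literature/Topology/FourManifolds` (trunk T-4MAN). Fact seat
`provefact-Literature.Topology.FourManifolds.Knot.IsConnectedSum.isIsotopic` (Schubert's theorem),
geometric heart for rail knots, model bridge. For a flip pair `(b₁, b₂)` (`FlipPair.lean`: common
crossing point `p₀ = pZero` of norm `2`, the reflection `R` of `𝕊³` read in the chart as the
inversion `sphereInv`), the reflection of the template knot of `b₁` at scale `κ`,
`R ∘ ψ⁻¹ ∘ blowDown₁ κ ∘ template σ = ψ⁻¹ ∘ sphereInv ∘ blowDown₁ κ ∘ template σ`, is isotopic to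
the **affine** template knot `ψ⁻¹ (p₀ + κ Ref_{p₀} (frame₁ (template σ)))`
(`isIsotopic_map_templateKnot_affine`): the rescaling family
`u ↦ p₀ + u⁻¹ (sphereInv (p₀ + u κ frame₁ (template σ)) - p₀)` (Hadamard quotient of
`w ↦ sphereInv (p₀ + w)`, `Literature.Analysis.Calculus.scaledDiff`) joins the two through
homothetic images of inverted template loops. By the frame relation of the pair
(`FlipPair.refl_frame`) and the coordinate structure of the template (first two coordinates free
of `σ`, third coordinate linear in `σ`: `template_eq_diag`) the affine map can be rewritten as
`κ frame₂ ∘ diag(-1, -1, 1)` at the depth sign `μ' σ` (`affineTemplateKnot_refl_eq`), an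
automorphism of **positive** determinant (`det_toMat_frame_negNeg_pos`).

Everything is proved; no named facts are introduced.

## References

* M. W. Hirsch, *Differential Topology*, GTM 33 (1976), Ch. 8 §1, Thm. 1.3; proof of Thm. 1.6.
  [HirschDT1976]
-/

open scoped Manifold ContDiff Topology Real
open Function Set Metric Filter

noncomputable section

namespace Literature.Topology.FourManifolds

/-- Local notation: `𝔼 n` is the model Euclidean space `EuclideanSpace ℝ (Fin n)`. -/
local notation "𝔼 " n:arg => EuclideanSpace ℝ (Fin n)

/-- Local notation: `𝕊 n` is the unit sphere in `EuclideanSpace ℝ (Fin (n + 1))`. -/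
local notation "𝕊 " n:arg => (Metric.sphere (0 : EuclideanSpace ℝ (Fin (n + 1))) 1)

attribute [local instance] fact_finrank_euclideanSpace_succ

open KnotsInBall ExitBend ModelTemplate Literature.Analysis.Calculus AffineIsotopy

/-! ### The reflection in the chart -/

/-- **The reflection of a chart point is the inverted chart point**: `R (ψ⁻¹ y) = ψ⁻¹ (sphereInv y)`
for `y ≠ 0`. [folklore] -/
theorem reflectLast_psiN_symm {y : 𝔼 3} (hy : y ≠ 0) : reflectLast 3 (psiN.symm y) = psiN.symm (sphereInv y) := by
  have hN : psiN.symm y ≠ northPole := psiN_symm_ne_northPole y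
  have hS : reflectLast 3 (psiN.symm y) ≠ northPole := by
    rw [Ne, reflectLast_eq_northPole_iff]
    intro h
    have : psiN (psiN.symm y) = 0 := by rw [h, psiN_southPole]
    rw [psiN_apply_psiN_symm] at this
    exact hy this
  have h := psiN_reflectLast hN hS
  rw [psiN_apply_psiN_symm] at h
  rw [← psiN_symm_apply_psiN hS, h]

/-- **A chart loop avoiding the origin stays a chart loop under the inversion.** [folklore] -/
theorem IsChartLoopN.sphereInv_comp {k : ℝ → 𝔼 3} (hk : IsChartLoopN k) (h0 : ∀ s, k s ≠ 0) :
    IsChartLoopN fun s ↦ sphereInv (k s) := by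
  have hd : ∀ s, HasDerivAt k (deriv k s) s := fun s ↦ ((hk.contDiff.differentiable (by simp)) s).hasDerivAt
  refine ⟨?_, fun s ↦ by simp only [hk.periodic s], fun s hs ↦ ?_, fun s t hst ↦ ?_⟩
  · exact contDiff_iff_contDiffAt.2 fun s ↦ (contDiffAt_sphereInv (h0 s)).comp s hk.contDiff.contDiffAt
  · have h1 : HasDerivAt (fun s ↦ sphereInv (k s)) _ s := (StageOrientationSign.hasFDerivAt_sphereInv (h0 s)).comp_hasDerivAt s (hd s)
    rw [h1.deriv] at hs
    have hn : 0 < ((2 : ℝ) / ‖k s‖) ^ 2 := by have := norm_pos_iff.2 (h0 s); positivity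
    rw [show ((((2 : ℝ) / ‖k s‖) ^ 2 • ((ℝ ∙ k s)ᗮ.reflection : (𝔼 3) →L[ℝ] 𝔼 3)) (deriv k s))
        = ((2 : ℝ) / ‖k s‖) ^ 2 • ((ℝ ∙ k s)ᗮ.reflection (deriv k s)) from rfl, smul_eq_zero] at hs
    rcases hs with hs | hs
    · exact absurd hs hn.ne'
    · exact hk.deriv_ne_zero s ((Submodule.reflection _).injective (hs.trans (map_zero _).symm))
  · exact hk.inj s t (by rw [← sphereInv_sphereInv (k s), hst, sphereInv_sphereInv])

/-! ### The coordinate structure of the template -/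

namespace ModelTemplate

/-- **The template in terms of the template of depth sign `1`**: first two coordinates free of
`σ`, third coordinate `σ` times that of `σ = 1`. [folklore] -/
theorem templateRaw_eq_diag (σ p : ℝ) :
    templateRaw σ p = pt3 ((templateRaw 1 p) 0) ((templateRaw 1 p) 1) (σ * (templateRaw 1 p) 2) := by
  rcases le_or_gt p (-(7 / 8)) with h1 | h1
  · simp only [templateRaw_of_le h1]
    ext i; fin_cases i <;> (simp [lowerModel, modelLo, pt3]; try ring)
  rcases le_or_gt p (7 / 16) with h2 | h2
  · simp only [templateRaw_of_mem_seg ⟨by linarith, h2⟩]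
    ext i; fin_cases i <;> (simp [cO, dLo, pt3]; try ring)
  rcases le_or_gt p 1 with h3 | h3
  · simp only [templateRaw_of_mem_arc ⟨by linarith, h3⟩]
    ext i; fin_cases i <;> (simp [bendArc, cO, dLo, dHi, pt3]; try ring)
  rcases le_or_gt p 6 with h4 | h4
  · simp only [templateRaw_of_mem_upper ⟨by linarith, h4⟩]
    ext i; fin_cases i <;> (simp [upperModel, modelHi, pt3]; try ring)
  · simp only [templateRaw_of_ge (show (8 / 3 : ℝ) ≤ p by linarith)]
    ext i; fin_cases i <;> simp [foreignModel, pt3]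

/-- The same for the template loop. [folklore] -/
theorem template_eq_diag (σ s : ℝ) : template σ s = pt3 ((template 1 s) 0) ((template 1 s) 1) (σ * (template 1 s) 2) := by
  simp only [template, periodise]; exact templateRaw_eq_diag σ _

/-- **The template loop is bounded** (continuous and periodic). [folklore] -/
theorem exists_norm_template_le (σ : ℝ) : ∃ C : ℝ, ∀ s, ‖template σ s‖ ≤ C := by
  obtain ⟨C, hC⟩ := isCompact_Icc.exists_bound_of_continuousOn (s := Icc (0 : ℝ) 1) (contDiff_template σ).continuous.continuousOn
  refine ⟨C, fun s ↦ ?_⟩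
  rw [← (periodic_template σ).apply_fract s]
  exact hC _ ⟨Int.fract_nonneg s, (Int.fract_lt_one s).le⟩

end ModelTemplate

/-! ### The operator `diag(-1, -1, 1)` -/

/-- The coordinate involution `(Y₀, Y₁, Y₂) ↦ (-Y₀, -Y₁, Y₂)` as a matrix. [folklore] -/
def negNegMat : Matrix (Fin 3) (Fin 3) ℝ := Matrix.diagonal ![-1, -1, 1]

/-- The coordinate involution as an operator. [folklore] -/
def negNegCLM : (𝔼 3) →L[ℝ] 𝔼 3 := toCLM negNegMat

/-- The coordinate involution applied. [folklore] -/
theorem negNegCLM_apply (Y : 𝔼 3) : negNegCLM Y = pt3 (-Y 0) (-Y 1) (Y 2) := by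
  ext i
  rw [negNegCLM, toCLM_apply]
  fin_cases i <;> simp [negNegMat, Matrix.diagonal]

/-- The coordinate involution is an involution. [folklore] -/
theorem negNegCLM_negNegCLM (Y : 𝔼 3) : negNegCLM (negNegCLM Y) = Y := by
  rw [negNegCLM_apply, negNegCLM_apply]
  ext i; fin_cases i <;> simp

/-- The coordinate involution as an automorphism. [folklore] -/
def negNegCLE : (𝔼 3) ≃L[ℝ] 𝔼 3 :=
  ContinuousLinearEquiv.equivOfInverse negNegCLM negNegCLM negNegCLM_negNegCLM negNegCLM_negNegCLM

/-- The automorphism as an operator. [folklore] -/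
theorem coe_negNegCLE : (negNegCLE : (𝔼 3) →L[ℝ] 𝔼 3) = negNegCLM := rfl

/-- The matrix of the coordinate involution has determinant `1`. [folklore] -/
theorem det_toMat_negNegCLM : (toMat negNegCLM).det = 1 := by
  rw [negNegCLM, toMat_toCLM, negNegMat, Matrix.det_diagonal]
  simp [Fin.prod_univ_three]

/-! ### The matrix and the determinant of a crossing frame -/

namespace BandData

variable {A B K : Knot} {avoid : Set (𝕊 3)} (b : BandData A B K avoid)
  (hcross : b.band ⁻¹' sphereEquator 2 ∩ squareNhd b.δ = {x ∈ squareNhd b.δ | x 0 = 2⁻¹})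

/-- **The operator of the frame matrix is the frame.** [folklore] -/
theorem toCLM_frameMat : toCLM b.frameMat = ((b.frame hcross : (𝔼 3) ≃L[ℝ] 𝔼 3) : (𝔼 3) →L[ℝ] 𝔼 3) := by
  ext Y i
  rw [toCLM_apply, ContinuousLinearEquiv.coe_coe, frame_apply]
  fin_cases i <;> simp [frameMat, Matrix.transpose_apply, Fin.sum_univ_three, vec3] <;> ring

/-- The matrix of the frame is the frame matrix. [folklore] -/
theorem toMat_frame : toMat ((b.frame hcross : (𝔼 3) ≃L[ℝ] 𝔼 3) : (𝔼 3) →L[ℝ] 𝔼 3) = b.frameMat := by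
  rw [← b.toCLM_frameMat hcross, toMat_toCLM]

/-- **The frame has positive determinant.** [folklore] -/
theorem det_toMat_frame_pos : 0 < (toMat ((b.frame hcross : (𝔼 3) ≃L[ℝ] 𝔼 3) : (𝔼 3) →L[ℝ] 𝔼 3)).det := by
  rw [b.toMat_frame hcross]; exact b.det_frameMat_pos hcross

/-- The scaled frame `κ • frame` as an automorphism (`κ ≠ 0`). [folklore] -/
def scaledFrame {κ : ℝ} (hκ : κ ≠ 0) : (𝔼 3) ≃L[ℝ] 𝔼 3 := smulEquiv hκ (b.frame hcross)

/-- The scaled frame as an operator. [folklore] -/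
theorem coe_scaledFrame {κ : ℝ} (hκ : κ ≠ 0) :
    ((b.scaledFrame hcross hκ : (𝔼 3) ≃L[ℝ] 𝔼 3) : (𝔼 3) →L[ℝ] 𝔼 3) = κ • ((b.frame hcross : (𝔼 3) ≃L[ℝ] 𝔼 3) : (𝔼 3) →L[ℝ] 𝔼 3) :=
  rfl

/-- The scaled frame applied: `κ • frame Y`. [folklore] -/
theorem scaledFrame_apply {κ : ℝ} (hκ : κ ≠ 0) (Y : 𝔼 3) : b.scaledFrame hcross hκ Y = κ • b.frame hcross Y := rfl

/-- **The scaled frame has positive determinant for `κ > 0`.** [folklore] -/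
theorem det_toMat_scaledFrame_pos {κ : ℝ} (hκ : 0 < κ) :
    0 < (toMat ((b.scaledFrame hcross hκ.ne' : (𝔼 3) ≃L[ℝ] 𝔼 3) : (𝔼 3) →L[ℝ] 𝔼 3)).det := by
  rw [scaledFrame, toMat_smulEquiv, Matrix.det_smul, Fintype.card_fin]
  exact mul_pos (pow_pos hκ 3) (b.det_toMat_frame_pos hcross)

/-- The scaled frame composed with the coordinate involution. [folklore] -/
def scaledFrameNeg {κ : ℝ} (hκ : κ ≠ 0) : (𝔼 3) ≃L[ℝ] 𝔼 3 := negNegCLE.trans (b.scaledFrame hcross hκ)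

/-- The composite applied: `κ • frame (-Y₀, -Y₁, Y₂)`. [folklore] -/
theorem scaledFrameNeg_apply {κ : ℝ} (hκ : κ ≠ 0) (Y : 𝔼 3) :
    b.scaledFrameNeg hcross hκ Y = κ • b.frame hcross (pt3 (-Y 0) (-Y 1) (Y 2)) := by
  rw [scaledFrameNeg, ContinuousLinearEquiv.trans_apply, scaledFrame_apply]
  congr 2
  exact negNegCLM_apply Y

/-- **The composite has positive determinant for `κ > 0`.** [folklore] -/
theorem det_toMat_scaledFrameNeg_pos {κ : ℝ} (hκ : 0 < κ) :
    0 < (toMat ((b.scaledFrameNeg hcross hκ.ne' : (𝔼 3) ≃L[ℝ] 𝔼 3) : (𝔼 3) →L[ℝ] 𝔼 3)).det := by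
  have e : ((b.scaledFrameNeg hcross hκ.ne' : (𝔼 3) ≃L[ℝ] 𝔼 3) : (𝔼 3) →L[ℝ] 𝔼 3) =
      ((b.scaledFrame hcross hκ.ne' : (𝔼 3) ≃L[ℝ] 𝔼 3) : (𝔼 3) →L[ℝ] 𝔼 3).comp negNegCLM := rfl
  rw [e, toMat_comp, Matrix.det_mul, det_toMat_negNegCLM, mul_one]
  exact b.det_toMat_scaledFrame_pos hcross hκ

/-- **The template knot is the affine template knot of `(pZero, κ frame)`.** [folklore] -/
theorem templateKnot_eq_affineTemplateKnot {κ : ℝ} (hκ : κ ≠ 0) (σ : ℝ) :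
    b.templateKnot hcross hκ σ = affineTemplateKnot b.pZero (L := ((b.scaledFrame hcross hκ : (𝔼 3) ≃L[ℝ] 𝔼 3) : (𝔼 3) →L[ℝ] 𝔼 3))
      (b.scaledFrame hcross hκ).injective σ := by
  symm
  exact (isChartLoopN_affine_template (L := ((b.scaledFrame hcross hκ : (𝔼 3) ≃L[ℝ] 𝔼 3) : (𝔼 3) →L[ℝ] 𝔼 3)) b.pZero
    (b.scaledFrame hcross hκ).injective σ).toKnot_eq_of_forall fun t ↦ by
      rw [b.templateKnot_circlePt hcross hκ]; rfl

/-- **ALL TEMPLATE KNOTS ARE ISOTOPIC TO ALL AFFINE TEMPLATE KNOTS OF POSITIVE DETERMINANT**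
(`κ > 0`; any depth signs): the σ-family and the `GL⁺` affine move. [cite: HirschDT1976, Ch. 8 §1, Thm. 1.3] -/
theorem isIsotopic_templateKnot_affineTemplateKnot {κ : ℝ} (hκ : 0 < κ) (σ : ℝ) (q : 𝔼 3) (L : (𝔼 3) ≃L[ℝ] 𝔼 3)
    (hL : 0 < (toMat (L : (𝔼 3) →L[ℝ] 𝔼 3)).det) (σ' : ℝ) :
    (b.templateKnot hcross hκ.ne' σ).IsIsotopic (affineTemplateKnot q (L := (L : (𝔼 3) →L[ℝ] 𝔼 3)) L.injective σ') := by
  rw [b.templateKnot_eq_affineTemplateKnot hcross hκ.ne' σ]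
  have h1 := isIsotopic_affineTemplateKnot_sigma b.pZero (L := ((b.scaledFrame hcross hκ.ne' : (𝔼 3) ≃L[ℝ] 𝔼 3) : (𝔼 3) →L[ℝ] 𝔼 3))
    (b.scaledFrame hcross hκ.ne').injective σ σ'
  have h2 := isIsotopic_affine_template b.pZero q 0 (b.scaledFrame hcross hκ.ne') L
    (mul_pos (b.det_toMat_scaledFrame_pos hcross hκ) hL) σ'
  simp only [map_zero, sub_zero] at h2
  exact IsAmbientIsotopic.trans_holds h1 h2

end BandData

/-! ### The reflected template of a flip pair -/

namespace BandData

namespace IsFlipPair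

variable {A₁ B₁ K₁ : Knot} {b₁ : BandData A₁ B₁ K₁ ∅} {A₂ B₂ K₂ : Knot} {b₂ : BandData A₂ B₂ K₂ ∅}
  (hP : IsFlipPair b₁ b₂)
  (hcross₁ : b₁.band ⁻¹' sphereEquator 2 ∩ squareNhd b₁.δ = {x ∈ squareNhd b₁.δ | x 0 = 2⁻¹})
  (hcross₂ : b₂.band ⁻¹' sphereEquator 2 ∩ squareNhd b₂.δ = {x ∈ squareNhd b₂.δ | x 0 = 2⁻¹})

/-- **The inversion recentred at the crossing point**: `g w = sphereInv (p₀ + w)`. [folklore] -/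
def invMap (_hP : IsFlipPair b₁ b₂) (w : 𝔼 3) : 𝔼 3 := sphereInv (b₂.pZero + w)

include hcross₂ in
/-- Points `p₀ + w`, `‖w‖ < 1`, are nonzero (`‖p₀‖ = 2`). [folklore] -/
theorem pZero_add_ne_zero {w : 𝔼 3} (hw : ‖w‖ < 1) : b₂.pZero + w ≠ 0 := by
  intro h
  have h1 : ‖b₂.pZero‖ = ‖-w‖ := by rw [show b₂.pZero = -w from eq_neg_of_add_eq_zero_left h]
  rw [norm_neg, b₂.norm_pZero hcross₂] at h1
  linarith

include hcross₂ in
/-- The recentred inversion is `C^∞` on the unit ball. [folklore] -/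
theorem contDiffOn_invMap : ContDiffOn ℝ ∞ (invMap hP) (ball 0 1) := fun w hw ↦ by
  have hw' : ‖w‖ < 1 := by simpa using hw
  exact ((contDiffAt_sphereInv (pZero_add_ne_zero hcross₂ hw')).comp w (contDiffAt_const.add contDiffAt_id)).contDiffWithinAt

include hcross₂ in
/-- The recentred inversion fixes the origin: `g 0 = p₀`. [folklore] -/
theorem invMap_zero : invMap hP 0 = b₂.pZero := by
  rw [invMap, add_zero, sphereInv_of_norm_eq_two (b₂.norm_pZero hcross₂)]

include hcross₂ in
/-- The derivative of the recentred inversion at the origin is the reflection `Ref_{p₀}`. [folklore] -/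
theorem fderiv_invMap_zero : fderiv ℝ (invMap hP) 0 = refl b₂.pZero := by
  have h1 : HasFDerivAt (fun w : 𝔼 3 ↦ b₂.pZero + w) (ContinuousLinearMap.id ℝ (𝔼 3)) 0 := (hasFDerivAt_id 0).const_add _
  have h2 : HasFDerivAt sphereInv (refl b₂.pZero) (b₂.pZero + 0) := by
    rw [add_zero]; exact hasFDerivAt_sphereInv_refl (b₂.norm_pZero hcross₂)
  have h := h2.comp 0 h1
  rw [ContinuousLinearMap.comp_id] at h
  exact h.fderiv

/-- **THE RESCALING FAMILY OF THE REFLECTED TEMPLATE**: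
`u ↦ p₀ + scaledDiff ğ u (κ frame₁ (template σ s))`. [folklore] -/
def reflFam (κ σ u s : ℝ) : 𝔼 3 :=
  b₂.pZero + scaledDiff (ballLocalize (invMap hP) 1) u (κ • b₁.frame hcross₁ (template σ s))

include hcross₂ in
/-- The rescaling family is jointly `C^∞` in `(u, s)`. [folklore] -/
theorem contDiff_reflFam (κ σ : ℝ) : ContDiff ℝ ∞ (uncurry (reflFam hP hcross₁ κ σ)) := by
  have h1 : ContDiff ℝ ∞ fun x : ℝ × ℝ ↦ κ • b₁.frame hcross₁ (template σ x.2) :=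
    (((b₁.frame hcross₁ : (𝔼 3) ≃L[ℝ] 𝔼 3) : (𝔼 3) →L[ℝ] 𝔼 3).contDiff.comp ((contDiff_template σ).comp contDiff_snd)).const_smul κ
  have h2 := (contDiff_scaledDiff_ballLocalize (f := invMap hP) one_pos (contDiffOn_invMap hP hcross₂)).comp (contDiff_fst.prodMk h1)
  exact contDiff_const.add h2

include hcross₂ in
/-- **At `u = 0`**: the affine loop `p₀ + κ Ref (frame₁ (template σ s))`. [folklore] -/
theorem reflFam_zero (κ σ s : ℝ) :
    reflFam hP hcross₁ κ σ 0 s = b₂.pZero + κ • refl b₂.pZero (b₁.frame hcross₁ (template σ s)) := by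
  rw [reflFam, scaledDiff_ballLocalize_zero_left one_pos, fderiv_invMap_zero hP hcross₂, map_smul]

include hcross₂ in
/-- **At `u ≠ 0` with `‖u κ frame₁ (template σ s)‖ ≤ 1/2`**: a homothetic image of the inverted
point `sphereInv (blowDown₁ (u κ) (template σ s))`. [folklore] -/
theorem reflFam_of_ne_zero {κ σ u : ℝ} (hu : u ≠ 0) {s : ℝ} (hs : ‖u • (κ • b₁.frame hcross₁ (template σ s))‖ ≤ 1 / 2) :
    reflFam hP hcross₁ κ σ u s = (b₂.pZero - u⁻¹ • b₂.pZero) + u⁻¹ • sphereInv (b₁.blowDown hcross₁ (u * κ) (template σ s)) := by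
  rw [reflFam, scaledDiff_ballLocalize_of_ne_zero one_pos (contDiffOn_invMap hP hcross₂) hu hs, invMap_zero hP hcross₂, invMap, blowDown,
    hP.pZero_eq (hcross₂ := hcross₂) (hcross₁ := hcross₁), smul_smul, smul_sub]
  abel

include hcross₂ in
/-- **At `u = 1`** (`‖κ frame₁ (template σ s)‖ ≤ 1/2`): the inverted template point. [folklore] -/
theorem reflFam_one {κ σ s : ℝ} (hs : ‖κ • b₁.frame hcross₁ (template σ s)‖ ≤ 1 / 2) :
    reflFam hP hcross₁ κ σ 1 s = sphereInv (b₁.blowDown hcross₁ κ (template σ s)) := by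
  rw [reflFam_of_ne_zero hP hcross₁ hcross₂ one_ne_zero (by rwa [one_smul]), one_mul, inv_one, one_smul, one_smul, sub_self, zero_add]

include hP hcross₂ in
/-- The inverted template points are not the origin (`‖κ frame₁ (template σ s)‖ ≤ 1/2`). [folklore] -/
theorem blowDown_template_ne_zero {κ σ s : ℝ} (hs : ‖κ • b₁.frame hcross₁ (template σ s)‖ ≤ 1 / 2) :
    b₁.blowDown hcross₁ κ (template σ s) ≠ 0 := by
  rw [blowDown, hP.pZero_eq (hcross₂ := hcross₂) (hcross₁ := hcross₁)]
  exact pZero_add_ne_zero hcross₂ (by linarith)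

include hcross₂ in
/-- **Every member of the rescaling family is a chart loop** (`κ ≠ 0`, `u ∈ [0, 1]`, smallness).
[folklore] -/
theorem isChartLoopN_reflFam {κ σ : ℝ} (hκ : κ ≠ 0) (hsmall : ∀ s, ‖κ • b₁.frame hcross₁ (template σ s)‖ ≤ 1 / 2) {u : ℝ}
    (hu : u ∈ Icc (0 : ℝ) 1) : IsChartLoopN (reflFam hP hcross₁ κ σ u) := by
  have hp := b₂.norm_pZero hcross₂
  rcases hu.1.eq_or_lt with h0 | h0
  · -- `u = 0`: affine
    rw [← h0]
    have e : reflFam hP hcross₁ κ σ 0 = fun s ↦ b₂.pZero + (κ • (refl b₂.pZero).comp ((b₁.frame hcross₁ : (𝔼 3) ≃L[ℝ] 𝔼 3) : (𝔼 3) →L[ℝ] 𝔼 3))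
        (template σ s) := by
      funext s; rw [reflFam_zero hP hcross₁ hcross₂]; rfl
    rw [e]
    refine isChartLoopN_affine_template _ (fun x y hxy ↦ ?_) σ
    have h1 : refl b₂.pZero (b₁.frame hcross₁ x) = refl b₂.pZero (b₁.frame hcross₁ y) := by
      simpa [smul_right_inj hκ] using hxy
    exact (b₁.frame hcross₁).injective (refl_injective hp h1)
  · -- `u > 0`: homothetic image of the inverted template at scale `u κ`
    have hsm : ∀ s, ‖u • (κ • b₁.frame hcross₁ (template σ s))‖ ≤ 1 / 2 := fun s ↦ by
      rw [norm_smul, Real.norm_eq_abs, abs_of_pos h0]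
      calc u * ‖κ • b₁.frame hcross₁ (template σ s)‖ ≤ 1 * (1 / 2) := mul_le_mul hu.2 (hsmall s) (norm_nonneg _) zero_le_one
        _ = 1 / 2 := one_mul _
    have e : reflFam hP hcross₁ κ σ u = fun s ↦ (b₂.pZero - u⁻¹ • b₂.pZero) +
        (u⁻¹ • ContinuousLinearMap.id ℝ (𝔼 3)) (sphereInv (b₁.blowDown hcross₁ (u * κ) (template σ s))) := by
      funext s; rw [reflFam_of_ne_zero hP hcross₁ hcross₂ h0.ne' (hsm s)]; rfl
    rw [e]
    have hk := b₁.isChartLoopN_blowDown_template hcross₁ (mul_ne_zero h0.ne' hκ) σ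
    have h0' : ∀ s, b₁.blowDown hcross₁ (u * κ) (template σ s) ≠ 0 := fun s ↦ by
      refine blowDown_template_ne_zero hP hcross₁ hcross₂ ?_
      rw [← smul_smul]; exact hsm s
    exact (hk.sphereInv_comp h0').affine _ fun x y hxy ↦ by simpa [smul_right_inj (inv_ne_zero h0.ne')] using hxy

include hcross₂ in
/-- The injectivity of `κ Ref ∘ frame₁` (`κ ≠ 0`). [folklore] -/
theorem injective_refl_frame {κ : ℝ} (hκ : κ ≠ 0) :
    Injective (κ • (refl b₂.pZero).comp ((b₁.frame hcross₁ : (𝔼 3) ≃L[ℝ] 𝔼 3) : (𝔼 3) →L[ℝ] 𝔼 3)) := fun x y hxy ↦ by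
  have h1 : refl b₂.pZero (b₁.frame hcross₁ x) = refl b₂.pZero (b₁.frame hcross₁ y) := by simpa [smul_right_inj hκ] using hxy
  exact (b₁.frame hcross₁).injective (refl_injective (b₂.norm_pZero hcross₂) h1)

include hP in
/-- **THE REFLECTED TEMPLATE KNOT IS ISOTOPIC TO THE AFFINE TEMPLATE KNOT OF `(p₀, κ Ref ∘ frame₁)`.**
[cite: HirschDT1976, Ch. 8 §1, Thm. 1.3; proof of Thm. 1.6] -/
theorem isIsotopic_map_templateKnot_affine {κ : ℝ} (hκ : κ ≠ 0) (σ : ℝ)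
    (hsmall : ∀ s, ‖κ • b₁.frame hcross₁ (template σ s)‖ ≤ 1 / 2) :
    ((b₁.templateKnot hcross₁ hκ σ).map (reflectLastDiffeo 3)).IsIsotopic
      (affineTemplateKnot b₂.pZero (injective_refl_frame hcross₁ hcross₂ hκ) σ) := by
  have h1 := isChartLoopN_reflFam hP hcross₁ hcross₂ hκ hsmall FlatHyp.one_mem01
  have h0 := isChartLoopN_reflFam hP hcross₁ hcross₂ hκ hsmall FlatHyp.zero_mem01
  -- the end knots
  have e1 : h1.toKnot = (b₁.templateKnot hcross₁ hκ σ).map (reflectLastDiffeo 3) := h1.toKnot_eq_of_forall fun t ↦ by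
    rw [SphereEmbedding.map_apply, coe_reflectLastDiffeo, b₁.templateKnot_circlePt hcross₁ hκ,
      reflectLast_psiN_symm (blowDown_template_ne_zero hP hcross₁ hcross₂ (hsmall t)), reflFam_one hP hcross₁ hcross₂ (hsmall t)]
  have e0 : h0.toKnot = affineTemplateKnot b₂.pZero (injective_refl_frame hcross₁ hcross₂ hκ) σ := h0.toKnot_eq_of_forall fun t ↦ by
    rw [affineTemplateKnot_circlePt, reflFam_zero hP hcross₁ hcross₂]; rfl
  rw [← e1, ← e0]
  -- the family
  have hC : ContDiff ℝ ∞ (uncurry fun u s ↦ ((psiN.symm (reflFam hP hcross₁ κ σ (1 - u) s) : 𝕊 3) : 𝔼 4)) := by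
    have h := (contDiff_reflFam hP hcross₁ hcross₂ κ σ).comp
      ((contDiff_const.sub contDiff_fst).prodMk contDiff_snd : ContDiff ℝ ∞ fun x : ℝ × ℝ ↦ (1 - x.1, x.2))
    exact BandData.contDiff_coe_psiN_symm.comp h
  have hmem : ∀ u ∈ Icc (0 : ℝ) 1, 1 - u ∈ Icc (0 : ℝ) 1 := fun u hu ↦ ⟨by linarith [hu.2], by linarith [hu.1]⟩
  exact IsRegularLoop.isIsotopic_of_family_eq h1.loop h0.loop h1.inj_coe h0.inj_coe
    (C := fun u s ↦ ((psiN.symm (reflFam hP hcross₁ κ σ (1 - u) s) : 𝕊 3) : 𝔼 4)) hC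
    (fun u hu ↦ (isChartLoopN_reflFam hP hcross₁ hcross₂ hκ hsmall (hmem u hu)).loop)
    (fun u hu ↦ (isChartLoopN_reflFam hP hcross₁ hcross₂ hκ hsmall (hmem u hu)).inj_coe)
    (by funext s; simp) (by funext s; simp)

/-! ### Rewriting the affine map through the frame of `b₂` -/

/-- The frame ratio of the pair read from `b₁` to `b₂`. [folklore] -/
def mu' : ℝ := hP.symm.mu hcross₁ hcross₂

/-- **The reflected frame of `b₁` on the template is the frame of `b₂` on the flipped template of
depth sign `μ' σ`.** [folklore] -/
theorem refl_frame_template (σ s : ℝ) :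
    refl b₂.pZero (b₁.frame hcross₁ (template σ s)) = b₂.frame hcross₂ (negNegCLM (template (mu' hP hcross₁ hcross₂ * σ) s)) := by
  rw [← hP.pZero_eq (hcross₂ := hcross₂) (hcross₁ := hcross₁), hP.symm.refl_frame hcross₁ hcross₂, negNegCLM_apply, mu']
  congr 1
  rw [template_eq_diag (hP.symm.mu hcross₁ hcross₂ * σ) s, template_eq_diag σ s]
  ext i; fin_cases i <;> simp; ring

/-- **THE AFFINE TEMPLATE KNOT OF `(p₀, κ Ref ∘ frame₁)` AT `σ` IS THAT OF `(p₀, κ frame₂ ∘ diag(-1,-1,1))`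
AT `μ' σ`** (the same chart loop). [folklore] -/
theorem affineTemplateKnot_refl_eq {κ : ℝ} (hκ : κ ≠ 0) (σ : ℝ) :
    affineTemplateKnot b₂.pZero (injective_refl_frame hcross₁ hcross₂ hκ) σ =
      affineTemplateKnot b₂.pZero (L := ((b₂.scaledFrameNeg hcross₂ hκ : (𝔼 3) ≃L[ℝ] 𝔼 3) : (𝔼 3) →L[ℝ] 𝔼 3))
        (b₂.scaledFrameNeg hcross₂ hκ).injective (mu' hP hcross₁ hcross₂ * σ) := by
  symm
  exact (isChartLoopN_affine_template (L := ((b₂.scaledFrameNeg hcross₂ hκ : (𝔼 3) ≃L[ℝ] 𝔼 3) : (𝔼 3) →L[ℝ] 𝔼 3)) _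
    (b₂.scaledFrameNeg hcross₂ hκ).injective _).toKnot_eq_of_forall fun t ↦ by
      rw [affineTemplateKnot_circlePt, ContinuousLinearEquiv.coe_coe, b₂.scaledFrameNeg_apply hcross₂ hκ, ← negNegCLM_apply,
        ← refl_frame_template hP hcross₁ hcross₂]
      rfl

include hP hcross₂ in
/-- **THE REFLECTED TEMPLATE KNOT OF `b₁` IS ISOTOPIC TO THE TEMPLATE KNOT OF ANY DATUM** (`κ, κ' > 0`,
smallness of `κ` on the template): through the affine template knot of `(p₀, κ frame₂ ∘ diag(-1,-1,1))`
of positive determinant. [cite: HirschDT1976, Ch. 8 §1, Thm. 1.3] -/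
theorem isIsotopic_map_templateKnot_templateKnot {κ : ℝ} (hκ : 0 < κ) (σ : ℝ)
    (hsmall : ∀ s, ‖κ • b₁.frame hcross₁ (template σ s)‖ ≤ 1 / 2)
    {A B K : Knot} {avoid : Set (𝕊 3)} (b : BandData A B K avoid)
    (hcross : b.band ⁻¹' sphereEquator 2 ∩ squareNhd b.δ = {x ∈ squareNhd b.δ | x 0 = 2⁻¹}) {κ' : ℝ} (hκ' : 0 < κ') (σ' : ℝ) :
    ((b₁.templateKnot hcross₁ hκ.ne' σ).map (reflectLastDiffeo 3)).IsIsotopic (b.templateKnot hcross hκ'.ne' σ') := by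
  have h1 := isIsotopic_map_templateKnot_affine hP hcross₁ hcross₂ hκ.ne' σ hsmall
  rw [affineTemplateKnot_refl_eq hP hcross₁ hcross₂ hκ.ne'] at h1
  have h2 := b.isIsotopic_templateKnot_affineTemplateKnot hcross hκ' σ' b₂.pZero (b₂.scaledFrameNeg hcross₂ hκ.ne')
    (b₂.det_toMat_scaledFrameNeg_pos hcross₂ hκ) (mu' hP hcross₁ hcross₂ * σ)
  exact IsAmbientIsotopic.trans_holds h1 (IsAmbientIsotopic.symm_holds h2)

/-- **Smallness holds for all small `κ`.** [folklore] -/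
theorem exists_small (σ : ℝ) : ∃ κ₀ : ℝ, 0 < κ₀ ∧ ∀ κ : ℝ, |κ| ≤ κ₀ → ∀ s, ‖κ • b₁.frame hcross₁ (template σ s)‖ ≤ 1 / 2 := by
  obtain ⟨C, hC⟩ := exists_norm_template_le σ
  set N := ‖((b₁.frame hcross₁ : (𝔼 3) ≃L[ℝ] 𝔼 3) : (𝔼 3) →L[ℝ] 𝔼 3)‖
  have hN : 0 ≤ N := norm_nonneg _
  have hC0 : 0 ≤ max C 0 := le_max_right _ _
  refine ⟨1 / (2 * (N * max C 0 + 1)), by positivity, fun κ hκ s ↦ ?_⟩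
  have h1 : ‖b₁.frame hcross₁ (template σ s)‖ ≤ N * max C 0 :=
    (((b₁.frame hcross₁ : (𝔼 3) ≃L[ℝ] 𝔼 3) : (𝔼 3) →L[ℝ] 𝔼 3).le_opNorm _).trans
      (mul_le_mul_of_nonneg_left ((hC s).trans (le_max_left _ _)) hN)
  rw [norm_smul, Real.norm_eq_abs]
  have h2 : |κ| * ‖b₁.frame hcross₁ (template σ s)‖ ≤ 1 / (2 * (N * max C 0 + 1)) * (N * max C 0) :=
    mul_le_mul hκ h1 (norm_nonneg _) (by positivity)
  refine h2.trans ?_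
  rw [div_mul_eq_mul_div, div_le_iff₀ (by positivity)]
  nlinarith

end IsFlipPair

end BandData

end Literature.Topology.FourManifolds
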